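/-
Solo-blind KontsevichZagierPeriods, sessions s20/s21 — ALL DEPTHS at the base point y = -1:
Deligne's order on value words, bracket trees, the expansion of an iterated commutator and the
leading-term / support facts (Λ1), (Λ2) for GOOD trees (standard bracketings of Lyndon words).
-/
import Summits.KontsevichZagierPeriods.KontsevichZagierPeriods.Theorems.SoloBlindDepthThree

/-!
# Bracket trees, signed arrangements and the Lyndon leading term

Pure combinatorics over a commutative ring, companion to `SoloBlindDepthThree` (chain rule) and
`SoloBlindAllDepths` (interval rule, interlacing).  Context (paper level, `hodge.md` §8.12 of the
solo-blind notes, NOT formalised here): the new corner direction of the mixed Tate structure of an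
odd Lyndon word `n = (n₁,…,n_k)` at `-1` is produced by the STANDARD BRACKETING `T_n` of `n`
evaluated on lifted block corners; the triangularity (T2)/(T3) of the corner matrix rests on two
facts about the expansion `T_n = Σ_u c_u u` into arrangements `u` of the letters:
(Λ2) every arrangement has reversed value word `⪰ n` in Deligne's order `⋯ ≺ 5 ≺ 3 ≺ 1`,
and (Λ1) the only arrangement with reversed value word `= n` is the reversed word, with sign
`(-1)^(k+1)`.  Both hold for every GOOD tree: at each node `[l, r]` the value word of
`l r` is `≺` that of `r l` (true for standard bracketings of Lyndon words, `ℓr ≺ rℓ`).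
This file proves:

* `DLex` and its API (irreflexive, transitive, total on equal lengths, concatenation splitting);
* `BTree`, `BTree.word`, `BTree.terms` (signed arrangements, no collection of like terms),
  `BTree.eval` (iterated commutator) and the EXPANSION `BTree.eval_eq_sum`:
  `eval W T = Σ_{(c,u) ∈ terms T} c • (u.map W).prod` in any `K`-algebra;
* invariants of arrangements (`length_of_mem_terms`, `sum_of_mem_terms`, `mem_word_of_mem_terms`);
* `BTree.Good`, **(Λ2)** `not_dlex_of_mem_terms`, **(Λ1)** `eq_reverse_of_mem_terms`, and the
  signed count `signedCount_eq` of the leading arrangements (`= (-1)^(k+1)`).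

Nothing about periods, Hodge theory or the Kontsevich–Zagier statement is claimed in this file.
-/

namespace Summit.KontsevichZagierPeriods.KontsevichZagierPeriods.Theorems

namespace SoloBlind

namespace LieTrees

open Matrix PolylogLadder DepthTwo DepthThree

/-! ## Deligne's order on value words -/

/-- Deligne's lexicographic order on words of natural numbers: a numerically LARGER letter is a
SMALLER letter (`⋯ ≺ 5 ≺ 3 ≺ 1`), words compared lexicographically. -/
def DLex (x y : List ℕ) : Prop := List.Lex (fun a b : ℕ => b < a) x y

/-- Comparison of two nonempty words. -/
theorem dlex_cons_iff {a b : ℕ} {x y : List ℕ} :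
    DLex (a :: x) (b :: y) ↔ b < a ∨ (a = b ∧ DLex x y) := by
  unfold DLex
  exact List.cons_lex_cons_iff

/-- No word is smaller than the empty word. -/
theorem not_dlex_nil (x : List ℕ) : ¬ DLex x [] := fun h => List.not_lex_nil h

/-- Irreflexivity. -/
theorem dlex_irrefl : ∀ x : List ℕ, ¬ DLex x x
  | [] => not_dlex_nil []
  | a :: x => fun h => by
    rcases dlex_cons_iff.mp h with h | ⟨_, h⟩
    · exact lt_irrefl a h
    · exact dlex_irrefl x h

/-- Transitivity. -/
theorem dlex_trans : ∀ {x y z : List ℕ}, DLex x y → DLex y z → DLex x z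
  | _, _, [], _, h2 => (not_dlex_nil _ h2).elim
  | _, [], _ :: _, h1, _ => (not_dlex_nil _ h1).elim
  | [], _ :: _, _ :: _, _, _ => List.Lex.nil
  | a :: x, b :: y, c :: z, h1, h2 => by
    rcases dlex_cons_iff.mp h1 with hba | ⟨hab, hxy⟩ <;>
      rcases dlex_cons_iff.mp h2 with hcb | ⟨hbc, hyz⟩
    · exact dlex_cons_iff.mpr (Or.inl (lt_trans hcb hba))
    · exact dlex_cons_iff.mpr (Or.inl (by rw [← hbc]; exact hba))
    · exact dlex_cons_iff.mpr (Or.inl (by rw [hab]; exact hcb))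
    · exact dlex_cons_iff.mpr (Or.inr ⟨hab.trans hbc, dlex_trans hxy hyz⟩)

/-- Totality on words of equal length. -/
theorem dlex_total : ∀ {x y : List ℕ}, x.length = y.length → x ≠ y → DLex x y ∨ DLex y x
  | [], [], _, h => (h rfl).elim
  | [], _ :: _, h, _ => by simp at h
  | _ :: _, [], h, _ => by simp at h
  | a :: x, b :: y, hl, hne => by
    rcases lt_trichotomy a b with h | rfl | h
    · exact Or.inr (dlex_cons_iff.mpr (Or.inl h))
    · have hxy : x ≠ y := fun e => hne (by rw [e])
      rcases dlex_total (by simpa using hl) hxy with h | h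
      · exact Or.inl (dlex_cons_iff.mpr (Or.inr ⟨rfl, h⟩))
      · exact Or.inr (dlex_cons_iff.mpr (Or.inr ⟨rfl, h⟩))
    · exact Or.inl (dlex_cons_iff.mpr (Or.inl h))

/-- Splitting a comparison of concatenations with first parts of equal length. -/
theorem dlex_append_split : ∀ {A r B l : List ℕ}, A.length = r.length →
    DLex (A ++ B) (r ++ l) → DLex A r ∨ (A = r ∧ DLex B l)
  | [], [], _, _, _, h => Or.inr ⟨rfl, by simpa using h⟩
  | [], _ :: _, _, _, h, _ => by simp at h
  | _ :: _, [], _, _, h, _ => by simp at h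
  | a :: A, c :: r, B, l, hl, h => by
    rw [List.cons_append, List.cons_append] at h
    rcases dlex_cons_iff.mp h with hca | ⟨hac, h'⟩
    · exact Or.inl (dlex_cons_iff.mpr (Or.inl hca))
    · rcases dlex_append_split (by simpa using hl) h' with h'' | ⟨hAr, h''⟩
      · exact Or.inl (dlex_cons_iff.mpr (Or.inr ⟨hac, h''⟩))
      · exact Or.inr ⟨by rw [hac, hAr], h''⟩

/-- Monotonicity of concatenation for `⪰`: if `¬ A ≺ r` and `¬ B ≺ l` (first parts of equal
length) then `¬ (A ++ B) ≺ (r ++ l)`. -/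
theorem not_dlex_append {A r B l : List ℕ} (hl : A.length = r.length) (hA : ¬ DLex A r)
    (hB : ¬ DLex B l) : ¬ DLex (A ++ B) (r ++ l) := by
  intro h
  rcases dlex_append_split hl h with h | ⟨_, h⟩
  · exact hA h
  · exact hB h

/-- `¬ X ≺ Y` and `n ≺ Y` (all of the same length) give `¬ X ≺ n` and `X ≠ n`. -/
theorem not_dlex_of_not_dlex_of_dlex {X Y m : List ℕ} (hXY : ¬ DLex X Y) (hmY : DLex m Y) :
    ¬ DLex X m ∧ X ≠ m := by
  constructor
  · intro h
    exact hXY (dlex_trans h hmY)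
  · rintro rfl
    exact hXY hmY

/-! ## Bracket trees and signed arrangements -/

/-- Binary bracketing trees with leaves labelled by `ι` (a leaf is a letter, a node is a
commutator). -/
inductive BTree (ι : Type*) where
  | leaf : ι → BTree ι
  | node : BTree ι → BTree ι → BTree ι

namespace BTree

variable {ι : Type*}

/-- The leaves of a tree, read from left to right. -/
def word : BTree ι → List ι
  | leaf m => [m]
  | node l r => word l ++ word r

/-- The SIGNED ARRANGEMENTS of a tree: the formal expansion of the iterated commutator into
signed words, term by term (no collection of like terms):
`[l, r] ↦ (l-terms)(r-terms) − (r-terms)(l-terms)`. -/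
def terms (K : Type*) [CommRing K] : BTree ι → List (K × List ι)
  | leaf m => [(1, [m])]
  | node l r =>
      ((terms K l) ×ˢ (terms K r)).map (fun pq => (pq.1.1 * pq.2.1, pq.1.2 ++ pq.2.2)) ++
      ((terms K r) ×ˢ (terms K l)).map (fun qp => (-(qp.1.1 * qp.2.1), qp.1.2 ++ qp.2.2))

variable {R : Type*} [Ring R]

/-- Evaluation of a tree on letters `W : ι → R`: leaves are the `W m`, nodes are commutators. -/
def eval (W : ι → R) : BTree ι → R
  | leaf m => W m
  | node l r => ⁅eval W l, eval W r⁆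

/-- Product of two list sums as a sum over the product list. -/
theorem sum_map_mul_sum_map {α β : Type*} (L₁ : List α) (L₂ : List β) (f : α → R)
    (g : β → R) :
    (L₁.map f).sum * (L₂.map g).sum = ((L₁ ×ˢ L₂).map fun p => f p.1 * g p.2).sum := by
  induction L₁ with
  | nil => simp
  | cons a t ih =>
    rw [List.map_cons, List.sum_cons, add_mul, ih, List.product_cons, List.map_append,
      List.sum_append, List.map_map]
    congr 1
    rw [← List.sum_map_mul_left]
    rfl

/-- Negation through a list sum. -/
theorem sum_map_neg' {α : Type*} (L : List α) (f : α → R) :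
    (L.map fun a => -f a).sum = -(L.map f).sum := by
  induction L with
  | nil => simp
  | cons a t ih => rw [List.map_cons, List.map_cons, List.sum_cons, List.sum_cons, ih, neg_add]

variable {K : Type*} [CommRing K] [Algebra K R]

/-- EXPANSION: the iterated commutator is the signed sum, over the signed arrangements, of the
corresponding products of letters. -/
theorem eval_eq_sum (W : ι → R) : ∀ T : BTree ι,
    eval W T = ((terms K T).map fun p => p.1 • (p.2.map W).prod).sum
  | leaf m => by simp [eval, terms]
  | node l r => by
    rw [eval, eval_eq_sum W l, eval_eq_sum W r, Ring.lie_def, terms, List.map_append,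
      List.sum_append, List.map_map, List.map_map, sum_map_mul_sum_map, sum_map_mul_sum_map,
      sub_eq_add_neg, ← sum_map_neg']
    congr 1
    · apply congrArg
      apply List.map_congr_left
      intro pq _
      simp only [Function.comp_apply, List.map_append, List.prod_append, smul_mul_smul_comm]
    · apply congrArg
      apply List.map_congr_left
      intro qp _
      simp only [Function.comp_apply, List.map_append, List.prod_append, smul_mul_smul_comm,
        neg_smul]

/-! ## Invariants of the signed arrangements -/

section Invariants

variable {K : Type*} [CommRing K]

/-- Membership in the signed arrangements of a node. -/
theorem mem_terms_node {l r : BTree ι} {p : K × List ι} :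
    p ∈ terms K (node l r) ↔
      (∃ a ∈ terms K l, ∃ b ∈ terms K r, p = (a.1 * b.1, a.2 ++ b.2)) ∨
      (∃ b ∈ terms K r, ∃ a ∈ terms K l, p = (-(b.1 * a.1), b.2 ++ a.2)) := by
  constructor
  · intro hp
    simp only [terms, List.mem_append, List.mem_map] at hp
    rcases hp with ⟨⟨a, b⟩, hab, rfl⟩ | ⟨⟨b, a⟩, hba, rfl⟩
    · exact Or.inl ⟨a, (List.mem_product.mp hab).1, b, (List.mem_product.mp hab).2, rfl⟩
    · exact Or.inr ⟨b, (List.mem_product.mp hba).1, a, (List.mem_product.mp hba).2, rfl⟩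
  · rintro (⟨a, ha, b, hb, rfl⟩ | ⟨b, hb, a, ha, rfl⟩)
    · simp only [terms, List.mem_append, List.mem_map]
      exact Or.inl ⟨(a, b), List.mem_product.mpr ⟨ha, hb⟩, rfl⟩
    · simp only [terms, List.mem_append, List.mem_map]
      exact Or.inr ⟨(b, a), List.mem_product.mpr ⟨hb, ha⟩, rfl⟩

/-- Every arrangement uses exactly the letters of the tree: same length. -/
theorem length_of_mem_terms : ∀ (T : BTree ι) {p : K × List ι}, p ∈ terms K T →
    p.2.length = (word T).length
  | leaf m, p, hp => by
    simp only [terms, List.mem_singleton] at hp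
    simp [hp, word]
  | node l r, p, hp => by
    rcases mem_terms_node.mp hp with ⟨a, ha, b, hb, rfl⟩ | ⟨b, hb, a, ha, rfl⟩
    · simp [word, length_of_mem_terms l ha, length_of_mem_terms r hb]
    · simp [word, length_of_mem_terms l ha, length_of_mem_terms r hb, add_comm]

/-- Every arrangement uses exactly the letters of the tree: same total degree. -/
theorem sum_of_mem_terms (deg : ι → ℕ) : ∀ (T : BTree ι) {p : K × List ι},
    p ∈ terms K T → (p.2.map deg).sum = ((word T).map deg).sum
  | leaf m, p, hp => by
    simp only [terms, List.mem_singleton] at hp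
    simp [hp, word]
  | node l r, p, hp => by
    rcases mem_terms_node.mp hp with ⟨a, ha, b, hb, rfl⟩ | ⟨b, hb, a, ha, rfl⟩
    · simp [word, sum_of_mem_terms deg l ha, sum_of_mem_terms deg r hb]
    · simp [word, sum_of_mem_terms deg l ha, sum_of_mem_terms deg r hb, add_comm]

/-- Every arrangement uses only letters of the tree. -/
theorem mem_word_of_mem_terms : ∀ (T : BTree ι) {p : K × List ι}, p ∈ terms K T →
    ∀ x ∈ p.2, x ∈ word T
  | leaf m, p, hp => by
    simp only [terms, List.mem_singleton] at hp
    simp [hp, word]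
  | node l r, p, hp => by
    rcases mem_terms_node.mp hp with ⟨a, ha, b, hb, rfl⟩ | ⟨b, hb, a, ha, rfl⟩
    · intro x hx
      simp only [List.mem_append] at hx
      simp only [word, List.mem_append]
      rcases hx with hx | hx
      · exact Or.inl (mem_word_of_mem_terms l ha x hx)
      · exact Or.inr (mem_word_of_mem_terms r hb x hx)
    · intro x hx
      simp only [List.mem_append] at hx
      simp only [word, List.mem_append]
      rcases hx with hx | hx
      · exact Or.inr (mem_word_of_mem_terms r hb x hx)
      · exact Or.inl (mem_word_of_mem_terms l ha x hx)

/-- A tree is GOOD for the degrees `deg` if at every node `[l, r]` the value word of `l ++ r` is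
Deligne-smaller than that of `r ++ l` (as for the standard bracketing of a Lyndon word). -/
def Good (deg : ι → ℕ) : BTree ι → Prop
  | leaf _ => True
  | node l r => Good deg l ∧ Good deg r ∧
      DLex ((word l).map deg ++ (word r).map deg) ((word r).map deg ++ (word l).map deg)

/-- (Λ2′) SUPPORT: in a good tree, the REVERSED value word of every signed arrangement is
`⪰` the value word of the tree. -/
theorem not_dlex_of_mem_terms (deg : ι → ℕ) : ∀ (T : BTree ι), Good deg T →
    ∀ {p : K × List ι}, p ∈ terms K T → ¬ DLex (p.2.map deg).reverse ((word T).map deg)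
  | leaf m, _, p, hp => by
    simp only [terms, List.mem_singleton] at hp
    simp [hp, word, dlex_irrefl]
  | node l r, hT, p, hp => by
    obtain ⟨hl, hr, hlr⟩ := hT
    rcases mem_terms_node.mp hp with ⟨a, ha, b, hb, rfl⟩ | ⟨b, hb, a, ha, rfl⟩
    · simp only [List.map_append, List.reverse_append, word]
      have hlen : ((b.2.map deg).reverse).length = ((word r).map deg).length := by
        simp [length_of_mem_terms r hb]
      exact (not_dlex_of_not_dlex_of_dlex (not_dlex_append hlen
        (not_dlex_of_mem_terms deg r hr hb) (not_dlex_of_mem_terms deg l hl ha)) hlr).1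
    · simp only [List.map_append, List.reverse_append, word]
      have hlen : ((a.2.map deg).reverse).length = ((word l).map deg).length := by
        simp [length_of_mem_terms l ha]
      exact not_dlex_append hlen (not_dlex_of_mem_terms deg l hl ha)
        (not_dlex_of_mem_terms deg r hr hb)

/-- Sign bookkeeping for (Λ1′). -/
theorem neg_mul_neg_one_pow (a b : ℕ) :
    -((-1 : K) ^ (b + 1) * (-1) ^ (a + 1)) = (-1) ^ (a + b + 1) := by
  ring

/-- (Λ1′) LEADING TERM: in a good tree, a signed arrangement whose reversed value word EQUALS the
value word of the tree is the reversed word of the tree, with sign `(-1)^(k+1)` (`k` leaves). -/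
theorem eq_reverse_of_mem_terms (deg : ι → ℕ) : ∀ (T : BTree ι), Good deg T →
    ∀ {p : K × List ι}, p ∈ terms K T → (p.2.map deg).reverse = (word T).map deg →
      p.2 = (word T).reverse ∧ p.1 = (-1) ^ ((word T).length + 1)
  | leaf m, _, p, hp, _ => by
    simp only [terms, List.mem_singleton] at hp
    simp [hp, word]
  | node l r, hT, p, hp, heq => by
    obtain ⟨hl, hr, hlr⟩ := hT
    rcases mem_terms_node.mp hp with ⟨a, ha, b, hb, rfl⟩ | ⟨b, hb, a, ha, rfl⟩
    · exfalso
      simp only [List.map_append, List.reverse_append, word] at heq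
      have hlen : ((b.2.map deg).reverse).length = ((word r).map deg).length := by
        simp [length_of_mem_terms r hb]
      exact (not_dlex_of_not_dlex_of_dlex (not_dlex_append hlen
        (not_dlex_of_mem_terms deg r hr hb) (not_dlex_of_mem_terms deg l hl ha)) hlr).2 heq
    · simp only [List.map_append, List.reverse_append, word] at heq ⊢
      have hlen : ((a.2.map deg).reverse).length = ((word l).map deg).length := by
        simp [length_of_mem_terms l ha]
      obtain ⟨ha', hb'⟩ := List.append_inj heq hlen
      obtain ⟨ha2, ha1⟩ := eq_reverse_of_mem_terms deg l hl ha ha'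
      obtain ⟨hb2, hb1⟩ := eq_reverse_of_mem_terms deg r hr hb hb'
      refine ⟨by rw [ha2, hb2], ?_⟩
      rw [ha1, hb1, List.length_append, neg_mul_neg_one_pow]

/-- A list sum of zeros. -/
theorem sum_map_eq_zero {α : Type*} (L : List α) (f : α → K) (h : ∀ x ∈ L, f x = 0) :
    (L.map f).sum = 0 := by
  induction L with
  | nil => simp
  | cons a t ih =>
    rw [List.map_cons, List.sum_cons, h a (by simp), ih (fun x hx => h x (by simp [hx])), add_zero]

/-- The SIGNED COUNT of the arrangements with reversed value word equal to the tree's value word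
is `(-1)^(k+1)` for a good tree with `k` leaves (there is exactly one such arrangement). -/
theorem signedCount_eq (deg : ι → ℕ) : ∀ (T : BTree ι), Good deg T →
    ((terms K T).map fun p => if (p.2.map deg).reverse = (word T).map deg then p.1 else 0).sum =
      (-1) ^ ((word T).length + 1)
  | leaf m, _ => by simp [terms, word]
  | node l r, hT => by
    have hl := hT.1
    have hr := hT.2.1
    rw [terms, List.map_append, List.sum_append, List.map_map, List.map_map,
      sum_map_eq_zero _ _ ?_, zero_add]
    · have key : ∀ qp ∈ terms K r ×ˢ terms K l,
          ((fun p : K × List ι => if (p.2.map deg).reverse = (word (node l r)).map deg then p.1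
            else 0) ∘ (fun qp : (K × List ι) × (K × List ι) =>
              (-(qp.1.1 * qp.2.1), qp.1.2 ++ qp.2.2))) qp =
          -((if (qp.1.2.map deg).reverse = (word r).map deg then qp.1.1 else 0) *
            (if (qp.2.2.map deg).reverse = (word l).map deg then qp.2.1 else 0)) := by
        rintro ⟨b, a⟩ hmem
        obtain ⟨hb, ha⟩ := List.mem_product.mp hmem
        have hlen : ((a.2.map deg).reverse).length = ((word l).map deg).length := by
          simp [length_of_mem_terms l ha]
        simp only [Function.comp_apply, word, List.map_append, List.reverse_append]
        by_cases hA : (a.2.map deg).reverse = (word l).map deg <;>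
          by_cases hB : (b.2.map deg).reverse = (word r).map deg
        · rw [if_pos (by rw [hA, hB]), if_pos hB, if_pos hA]
        · rw [if_neg (fun h => hB (List.append_inj h hlen).2), if_neg hB, if_pos hA]; ring
        · rw [if_neg (fun h => hA (List.append_inj h hlen).1), if_pos hB, if_neg hA]; ring
        · rw [if_neg (fun h => hA (List.append_inj h hlen).1), if_neg hB, if_neg hA]; ring
      rw [List.map_congr_left key, sum_map_neg',
        ← sum_map_mul_sum_map (terms K r) (terms K l)
          (fun b => if (b.2.map deg).reverse = (word r).map deg then b.1 else 0)
          (fun a => if (a.2.map deg).reverse = (word l).map deg then a.1 else 0),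
        signedCount_eq deg r hr, signedCount_eq deg l hl, word, List.length_append,
        neg_mul_neg_one_pow]
    · rintro ⟨a, b⟩ hmem
      obtain ⟨ha, hb⟩ := List.mem_product.mp hmem
      have hlen : ((b.2.map deg).reverse).length = ((word r).map deg).length := by
        simp [length_of_mem_terms r hb]
      simp only [Function.comp_apply, word, List.map_append, List.reverse_append]
      rw [if_neg]
      exact (not_dlex_of_not_dlex_of_dlex (not_dlex_append hlen
        (not_dlex_of_mem_terms deg r hr hb) (not_dlex_of_mem_terms deg l hl ha)) hT.2.2).2

end Invariants

end BTree

end LieTrees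

end SoloBlind

end Summit.KontsevichZagierPeriods.KontsevichZagierPeriods.Theorems
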